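import Summits.HodgeConjecture.HodgeConjecture.Theorems.K2E1bU21ModelIntertwiner   -- ★ 5b (K2E4-p10 (g3)): `exists_intertwiner_of_datum`
import Summits.HodgeConjecture.HodgeConjecture.Theorems.K2E1bGKStableOfLieStable   -- ★ 5a′ (K2-defs1 (g3)): `IsGKModule.isGKSubmodule_of_lieStable`
import Literature.RepresentationTheory.BorelWallach2000.UpqMaximalCompactExp      -- ★ `upq_exists_expK_eq` (`K = exp 𝔨` for `U(α, β)`)
import HarnessLib

/-!
# K2 ∕ E1b · 8b-αᵤ road FILE 5b §2 «THE MODEL EQUIVALENCE» (row αᵤ-5b, second head): the datum of an irreducible `(𝔤, K)`-module of `U(2,1)` at central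
# label `e` carries the structure of record `σOfRecord 𝒟 e`, and Kovačević's model is `𝔤`-ISOMORPHIC to the module

HCML Track B «K2-LIT», cell `hodgecm-mathlib`, crux H413 = stmt-HodgeConjecture-24833 (supports-only helper; closes nothing by itself).  Socket 8b-αᵤ
`sig_K2E1bModelOfRecordCohUnitary`; DEAL (D-αᵤ5b§2) K2E1b-plan (g4) → K2E4-p10 (g3) 2026-09-04T04:42:54Z ∕ 04:44:42Z (head-first bytes 04:47:19Z).  THEOREMS ONLY
(the equivalence is an `∃`; no `def`, no `sorry`, no instance declaration, no notation).

## The statement (`exists_lieEquiv_of_datum`)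

For `(𝔤, K)`-module data `(ρK, ρ𝔤)` of `U(2,1)` on `V`, IRREDUCIBLE (`IsIrreducibleGK`), and the datum `𝒟` ∕ witness family `u` of ★ `exists_datum` at central label `e`
(clauses (i) labels∕membership, (ii) `S ↔ u ≠ 0`, (iv) strings, (v) Theorem 1) with SOME `u n m ≠ 0`:
`∃ Φ : 𝒟.V ≃ₗ[ℂ] V, ∀ (X : G21.lie) (x : 𝒟.V), Φ (σOfRecord 𝒟 e X x) = ρ𝔤 X (Φ x)` — token for token the `T`, `hT` of ★ `IsGKModule.areGKEquivalent_of_lieEquiv`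
(record → module), consumed by the desk's head file `K2E1bModelOfRecordCohUnitary` (`modelOfRecordCohUnitary_of_lieEquivOfDatum (h5b)`).  The variant
`exists_lieEquiv_of_datum_vec` also records the basis values `Φ (u^k_{n,m}) = (−f)^{k−1} u_{n,m}`.

## The proof

★ 5b `exists_intertwiner_of_datum` gives an injective `Φ₀ : 𝒟.V →ₗ[ℂ] V` intertwining the nine matrix units of `𝔤𝔩(Fin 2 ⊕ Fin 1, ℂ)` under the complexified
actions; by `Matrix.matrix_eq_sum_single` and linearity it intertwines every complex matrix (`map_upqLieC_of_units`), hence every `X ∈ 𝔲(2,1)` (★ `upqLieC_coe`,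
`G21 = uFormGroup (Fin 2) (Fin 1)`).  So `range Φ₀` is `ρ𝔤`-stable, hence a `(𝔤, K)`-submodule (★ 5a′ `isGKSubmodule_of_lieStable` with ★ `upq_exists_expK_eq`),
hence `⊥` or `⊤` by irreducibility; it is not `⊥`: `u n m ≠ 0` forces `1 ≤ n` by the string (`f^0 u = u`), `(n, m) ∈ S`, and `Φ₀ (u^1_{n,m}) = u_{n,m} ≠ 0`.
`Φ := LinearEquiv.ofBijective Φ₀`.

Sources: [Kovacevic2021] §3 Def. 1, Thm. 1–2, Remark 2; [KnappVogan1995] §I.4 (1.64)–(1.65), §II.4; [BorelWallach2000] 0 §2.5, II §4.1; [Rogawski1990] §12.3 p. 177.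
HONEST LABEL: a helper of the 8b-αᵤ road (file 5b §2); it closes nothing by itself; HC_CM is proved only modulo the 7 printed citations (2 remaining named inputs:
hLiu418 = stmt-HodgeConjecture-24832, h413 = stmt-HodgeConjecture-24833) until rung 0 closes.
-/

-- Mathlib idiom (as in every ★ Kovačević ∕ αᵤ file): commutator bracket on `Module.End ℂ V` and on matrices.
attribute [local instance 100] LieRing.ofAssociativeRing

set_option autoImplicit false
set_option linter.dupNamespace false

noncomputable section

namespace Summit.HodgeConjecture.HodgeConjecture.Cruxes.H413.K2E1bU21ModelEquiv

open Literature.RepresentationTheory Literature.RepresentationTheory.KonnoKonno2007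
open Literature.RepresentationTheory.Kovacevic2021 Literature.RepresentationTheory.Kovacevic2021.SU21Datum
open Literature.RepresentationTheory.BorelWallach2000 (upq_exists_expK_eq)
open Literature.NumberTheory.Automorphic
open Summit.HodgeConjecture.HodgeConjecture.Cruxes.H413.F0P3bLocalAPacketsDefs
open Summit.HodgeConjecture.HodgeConjecture.Cruxes.H413.K2E1bU21Weights
open Summit.HodgeConjecture.HodgeConjecture.Cruxes.H413.K2E1bCarriersOfRecord
open Summit.HodgeConjecture.HodgeConjecture.Cruxes.H413.K2E1bU21ModelIntertwiner

variable {V : Type*} [AddCommGroup V] [Module ℂ V]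
  {ρK : Representation ℂ G21.maximalCompact V} (ρ𝔤 : G21.lie →ₗ⁅ℝ⁆ Module.End ℂ V)
  {e : ℤ} {𝒟 : SU21Datum} {u : ℤ → ℤ → V}

/-! ## §1 From the nine units to `𝔤𝔩(Fin 2 ⊕ Fin 1, ℂ)` and to `𝔲(2,1)` -/

/-- A linear map intertwining the nine matrix units under two complexified actions intertwines every complex matrix (`M = Σ E_{ij} M_{ij}`, linearity).
[cite: Knapp2002, VI §2] [cite: KnappVogan1995, §IV.1] -/
theorem map_upqLieC_of_units {W : Type*} [AddCommGroup W] [Module ℂ W] (σ : G21.lie →ₗ⁅ℝ⁆ Module.End ℂ W) (Φ : W →ₗ[ℂ] V)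
    (hunit : ∀ (i j : Fin 2 ⊕ Fin 1) (x : W), Φ (upqLieC σ (Matrix.single i j (1 : ℂ)) x) = upqLieC ρ𝔤 (Matrix.single i j (1 : ℂ)) (Φ x))
    (M : Matrix (Fin 2 ⊕ Fin 1) (Fin 2 ⊕ Fin 1) ℂ) (x : W) : Φ (upqLieC σ M x) = upqLieC ρ𝔤 M (Φ x) := by
  rw [Matrix.matrix_eq_sum_single M]
  simp only [map_sum, LinearMap.sum_apply]
  refine Finset.sum_congr rfl fun i _ => Finset.sum_congr rfl fun j _ => ?_
  have hs : Matrix.single i j (M i j) = M i j • Matrix.single i j (1 : ℂ) := by rw [Matrix.smul_single, smul_eq_mul, mul_one]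
  rw [hs, map_smul, map_smul, LinearMap.smul_apply, LinearMap.smul_apply, map_smul, hunit]

/-- The same on the real form: a linear map intertwining the nine units intertwines the two actions of `𝔲(2,1)` (★ `upqLieC_coe`: `ρ_ℂ(X) = ρ𝔤(X)` for `X ∈ 𝔲(2,1)`).
[cite: Knapp2002, VI §2] [cite: KnappVogan1995, §IV.1] -/
theorem map_lie_of_units {W : Type*} [AddCommGroup W] [Module ℂ W] (σ : G21.lie →ₗ⁅ℝ⁆ Module.End ℂ W) (Φ : W →ₗ[ℂ] V)
    (hunit : ∀ (i j : Fin 2 ⊕ Fin 1) (x : W), Φ (upqLieC σ (Matrix.single i j (1 : ℂ)) x) = upqLieC ρ𝔤 (Matrix.single i j (1 : ℂ)) (Φ x))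
    (X : G21.lie) (x : W) : Φ (σ X x) = ρ𝔤 X (Φ x) := by
  rw [← upqLieC_coe σ X, ← upqLieC_coe ρ𝔤 X]
  exact map_upqLieC_of_units ρ𝔤 σ Φ hunit _ x

/-! ## §2 The heads -/

/-- **THE MODEL EQUIVALENCE, with basis values** (see the module docstring): for irreducible `(𝔤, K)`-module data and the datum ∕ witness family of ★ `exists_datum`
with some `u n m ≠ 0`, a linear EQUIVALENCE `Φ : 𝒟.V ≃ₗ[ℂ] V` with `Φ (u^k_{n,m}) = (−f)^{k−1} u_{n,m}` and `Φ ∘ σOfRecord 𝒟 e X = ρ𝔤 X ∘ Φ` for every `X ∈ 𝔲(2,1)`.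
[cite: Kovacevic2021, §3 Def. 1, Thm. 1–2, Remark 2] [cite: KnappVogan1995, §I.4 (1.64)–(1.65), §II.4] [cite: BorelWallach2000, 0 §2.5] -/
theorem exists_lieEquiv_of_datum_vec (hGK : IsGKModule G21 ρK ρ𝔤) (hirr : IsIrreducibleGK ρK ρ𝔤)
    (hi : ∀ n m : ℤ, u n m ≠ 0 → ∃ w, labelN w = n ∧ labelM w = m ∧ labelE w = e ∧ u n m ∈ hwSpace ρ𝔤 w)
    (hS : ∀ n m : ℤ, (n, m) ∈ 𝒟.S ↔ u n m ≠ 0)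
    (hstr : ∀ n m : ℤ, u n m ≠ 0 → (u21f ρ𝔤 ^ n.toNat) (u n m) = 0 ∧ ∀ k < n.toNat, (u21f ρ𝔤 ^ k) (u n m) ≠ 0)
    (hT : ∀ (n m : ℤ) (k : ℕ),
      u21E ρ𝔤 0 (((-u21f ρ𝔤) ^ k) (u n m)) =
          (((n : ℂ) - k) * 𝒟.A n m) • ((-u21f ρ𝔤) ^ k) (u (n + 1) (m + 3)) + ((k : ℂ) * 𝒟.C n m) • ((-u21f ρ𝔤) ^ (k - 1)) (u (n - 1) (m + 3)) ∧
        u21E ρ𝔤 1 (((-u21f ρ𝔤) ^ k) (u n m)) =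
          (-𝒟.A n m) • ((-u21f ρ𝔤) ^ (k + 1)) (u (n + 1) (m + 3)) + 𝒟.C n m • ((-u21f ρ𝔤) ^ k) (u (n - 1) (m + 3)) ∧
        u21F ρ𝔤 1 (((-u21f ρ𝔤) ^ k) (u n m)) =
          (((n : ℂ) - k) * 𝒟.B n m) • ((-u21f ρ𝔤) ^ k) (u (n + 1) (m - 3)) - ((k : ℂ) * 𝒟.D n m) • ((-u21f ρ𝔤) ^ (k - 1)) (u (n - 1) (m - 3)) ∧
        u21F ρ𝔤 0 (((-u21f ρ𝔤) ^ k) (u n m)) =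
          𝒟.B n m • ((-u21f ρ𝔤) ^ (k + 1)) (u (n + 1) (m - 3)) + 𝒟.D n m • ((-u21f ρ𝔤) ^ k) (u (n - 1) (m - 3)))
    (hne : ∃ n m : ℤ, u n m ≠ 0) :
    ∃ Φ : 𝒟.V ≃ₗ[ℂ] V,
      (∀ n m k : ℤ, (n, m) ∈ 𝒟.S → 1 ≤ k → k ≤ n → Φ (𝒟.vec n m k) = ((-u21f ρ𝔤) ^ (k - 1).toNat) (u n m)) ∧
      ∀ (X : G21.lie) (x : 𝒟.V), Φ (σOfRecord 𝒟 e X x) = ρ𝔤 X (Φ x) := by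
  obtain ⟨Φ₀, hinj, hvec, hunit⟩ := exists_intertwiner_of_datum ρ𝔤 hi hS hstr hT
  have hlie : ∀ (X : G21.lie) (x : 𝒟.V), Φ₀ (σOfRecord 𝒟 e X x) = ρ𝔤 X (Φ₀ x) := map_lie_of_units ρ𝔤 (σOfRecord 𝒟 e) Φ₀ hunit
  -- `range Φ₀` is a `(𝔤, K)`-submodule
  have hW : ∀ (X : G21.lie) (w : V), w ∈ LinearMap.range Φ₀ → ρ𝔤 X w ∈ LinearMap.range Φ₀ := by
    rintro X w ⟨x, rfl⟩
    exact ⟨σOfRecord 𝒟 e X x, hlie X x⟩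
  have hGKW : IsGKSubmodule ρK ρ𝔤 (LinearMap.range Φ₀) := hGK.isGKSubmodule_of_lieStable upq_exists_expK_eq hW
  -- it is not `⊥`
  obtain ⟨n, m, hnm⟩ := hne
  have hn : 1 ≤ n := by
    by_contra hn
    have h0 := (hstr n m hnm).1
    rw [show n.toNat = 0 by omega, pow_zero, Module.End.one_apply] at h0
    exact hnm h0
  have hmem : u n m ∈ LinearMap.range Φ₀ := by
    refine ⟨𝒟.vec n m 1, ?_⟩
    rw [hvec n m 1 ((hS n m).2 hnm) le_rfl hn, sub_self, Int.toNat_zero, pow_zero, Module.End.one_apply]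
  have htop : LinearMap.range Φ₀ = ⊤ := by
    rcases hirr.2 _ hGKW with h | h
    · exact absurd ((Submodule.mem_bot ℂ).1 (h ▸ hmem)) hnm
    · exact h
  refine ⟨LinearEquiv.ofBijective Φ₀ ⟨hinj, LinearMap.range_eq_top.1 htop⟩, fun n m k hnm hk hkn => ?_, fun X x => ?_⟩
  · rw [LinearEquiv.ofBijective_apply, hvec n m k hnm hk hkn]
  · rw [LinearEquiv.ofBijective_apply, LinearEquiv.ofBijective_apply, hlie]

/-- **THE MODEL EQUIVALENCE** (the dealt head; see the module docstring): for irreducible `(𝔤, K)`-module data `(ρK, ρ𝔤)` of `U(2,1)` and the datum ∕ witness family of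
★ `exists_datum` at central label `e` with some `u n m ≠ 0`, `∃ Φ : 𝒟.V ≃ₗ[ℂ] V, ∀ X x, Φ (σOfRecord 𝒟 e X x) = ρ𝔤 X (Φ x)` — Kovačević's model with the structure of
record is `𝔤`-isomorphic to the module. [cite: Kovacevic2021, §3 Def. 1, Thm. 1–2, Remark 2] [cite: KnappVogan1995, §I.4 (1.64)–(1.65), §II.4] [cite: BorelWallach2000, 0 §2.5]
[cite: Rogawski1990, §12.3 p. 177] -/
theorem exists_lieEquiv_of_datum (hGK : IsGKModule G21 ρK ρ𝔤) (hirr : IsIrreducibleGK ρK ρ𝔤)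
    (hi : ∀ n m : ℤ, u n m ≠ 0 → ∃ w, labelN w = n ∧ labelM w = m ∧ labelE w = e ∧ u n m ∈ hwSpace ρ𝔤 w)
    (hS : ∀ n m : ℤ, (n, m) ∈ 𝒟.S ↔ u n m ≠ 0)
    (hstr : ∀ n m : ℤ, u n m ≠ 0 → (u21f ρ𝔤 ^ n.toNat) (u n m) = 0 ∧ ∀ k < n.toNat, (u21f ρ𝔤 ^ k) (u n m) ≠ 0)
    (hT : ∀ (n m : ℤ) (k : ℕ),
      u21E ρ𝔤 0 (((-u21f ρ𝔤) ^ k) (u n m)) =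
          (((n : ℂ) - k) * 𝒟.A n m) • ((-u21f ρ𝔤) ^ k) (u (n + 1) (m + 3)) + ((k : ℂ) * 𝒟.C n m) • ((-u21f ρ𝔤) ^ (k - 1)) (u (n - 1) (m + 3)) ∧
        u21E ρ𝔤 1 (((-u21f ρ𝔤) ^ k) (u n m)) =
          (-𝒟.A n m) • ((-u21f ρ𝔤) ^ (k + 1)) (u (n + 1) (m + 3)) + 𝒟.C n m • ((-u21f ρ𝔤) ^ k) (u (n - 1) (m + 3)) ∧
        u21F ρ𝔤 1 (((-u21f ρ𝔤) ^ k) (u n m)) =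
          (((n : ℂ) - k) * 𝒟.B n m) • ((-u21f ρ𝔤) ^ k) (u (n + 1) (m - 3)) - ((k : ℂ) * 𝒟.D n m) • ((-u21f ρ𝔤) ^ (k - 1)) (u (n - 1) (m - 3)) ∧
        u21F ρ𝔤 0 (((-u21f ρ𝔤) ^ k) (u n m)) =
          𝒟.B n m • ((-u21f ρ𝔤) ^ (k + 1)) (u (n + 1) (m - 3)) + 𝒟.D n m • ((-u21f ρ𝔤) ^ k) (u (n - 1) (m - 3)))
    (hne : ∃ n m : ℤ, u n m ≠ 0) :
    ∃ Φ : 𝒟.V ≃ₗ[ℂ] V, ∀ (X : G21.lie) (x : 𝒟.V), Φ (σOfRecord 𝒟 e X x) = ρ𝔤 X (Φ x) := by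
  obtain ⟨Φ, -, hΦ⟩ := exists_lieEquiv_of_datum_vec ρ𝔤 hGK hirr hi hS hstr hT hne
  exact ⟨Φ, hΦ⟩

end Summit.HodgeConjecture.HodgeConjecture.Cruxes.H413.K2E1bU21ModelEquiv

end
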